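import Summits.BirchSwinnertonDyer.Rank1Residual.Additive.ChiBranchInput
import Literature.NumberTheory.EllipticCurves.PAdicLFunctionMinus
import Literature.NumberTheory.EllipticCurves.ImaginaryPeriod
import HarnessLib

/-!
# X3 ∧ (semistable twist), `p ≡ 3 (mod 4)`: the ODD `χ`-branch of the twist at `T = 0`, TYPED (cell `b2b-bsdres`, seat additive-p4, line V9)

HONEST FRAMING (cell `b2b-bsdres`, run/shared/lean/b2b/bsd-rank1-residual/, verbatim in every
file): the goal of the cell is to DELETE the COMBINATION-SHAPED residual classes of the
Birch–Swinnerton-Dyer formula for ALL analytic-rank `≤ 1` elliptic curves over `ℚ` — "full BSD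
formula for every rank `≤ 1` curve in class `C`" assembled STRICTLY from published theorems — so
that the rank-`≤ 1` remainder becomes exactly the CONSTRUCTION-SHAPED classes, which are TYPED
(missing-input `Prop`s), NOT attempted. This is not "finishing BSD". The additive sub-cell (seats
additive-p1…p4) is a RESEARCH ROUTE on the construction-shaped classes X3/X4; no claim beyond the
stated classes; the label of X3 is UNCHANGED by this file.

Definitions only (two `def`s + one unfolding lemma); NOTHING is asserted. Odd twin of
`ChiBranchInput.lean` (p203015). For `p ≡ 3 (mod 4)` — the primes `p = 3, 7, …`, which carry 757 of
the 818 pairs of the V9 domain (HOME/b2b-bsdres-additive-p4/V9-CHAIN.md) — the quadratic character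
`χ_{p*} = ω^{(p−1)/2}`, `p* = −p`, is ODD, and the relevant branch of the Néron-normalised `p`-adic
`L`-function of the semistable twist `E♭` (`E = E♭ ⊗ χ_{p*}` additive of Kodaira type `I₀*`/`I_n*`)
lives on the MINUS modular symbols `[r]⁻` (tree `ratMinusSymbol`, file `PAdicLFunctionMinus`,
Mazur–Tate–Teitelbaum 1986 §I.8) and the imaginary Néron period `Ω⁻(E♭)` (tree
`imaginaryPeriodRat`, file `ImaginaryPeriod`; Pal 2012 p. 1514). As on the even side only the value
at the trivial character of `Γ` is typed (the tree has the odd-branch measure `msdMinusMeasure` but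
not yet its distribution relation):

* `legendreMinusSymbolSum f p = ∑_{a mod p} (a/p)·[a/p]⁻_f ∈ ℚ` — cast to `ℂ` it is the tree's
  `ratMinusTwistedSymbolSum f χ_p`, hence `τ(χ_p)·L(f, χ_p, 1)/(Ω⁻_f·i)` by the ODD Birch formula
  (tree theorem `ratMinusTwistedSymbolSum_mul_minusPeriod_mul_I`);
* `ChiBranchLeadingTermOddAt W p` — **[B∘C] at `T = 0`, odd branch, TYPED**: for `W` (the additive
  curve) `ℚ`-isomorphic to the twist by `−p` of a globally minimal `V` good ordinary or
  multiplicative at `p`, `E[p]` reducible, `f` the newform of `V`, `κ/γ` cyclotomic, `D` a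
  Selmer-dual datum of `W` over `ℚ_∞`, and `ϖ⁻ ∈ ℚ` with `ϖ⁻ · |Ω⁻(V)| = Ω⁻_f` (the minus twin of
  the tree's `ϖ · Ω_V = Ω⁺_f`): `X(W/ℚ_∞)` is `Λ`-torsion and SOME `g ∈ char_Λ X(W/ℚ_∞)` has
  `g(0) = u · ϖ⁻ · ∑_{a mod p} (a/p)[a/p]⁻_f`, `u ∈ ℤ_p^×` — the `T = 0` specialisation of
  "`char X(E/ℚ_∞) ∋` the `χ_{−p}`-branch of `L_p(E♭)`" (Wuthrich 2014 Thm. 16 for `E♭` over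
  `ℚ(μ_{p^∞})`, `ω^{(p−1)/2}`-component, Lemma 17; transported along the classical prime-to-`p`
  descent `X(E/ℚ_∞) ≅ X(E♭/ℚ(μ_{p^∞}))^{(χ)}` [C], Greenberg LNM 1716 §5; value at `T = 0` by
  MTT §I.14 with the minus symbol: `α⁻¹ ∑ χ(a)[a/p]⁻_{E♭}`, `[r]⁻_{E♭} = (Ω⁻_f/Ω⁻_{E♭})·[r]⁻_f` up to
  a power of `2`; `u` absorbs `α⁻¹` resp. `a_p(E♭) = ±1`, signs and powers of `2`).
Consumer: `Additive/X3RankZeroSemistableTwistOdd.lean` (the odd assembly: Delbourgo 1998 Prop. 4 +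
this input + odd Birch + Pal 2012 Thm. 3.2 (`d < 0`, PROVED in the tree) + GZK).

References: Wuthrich 2014 [Wuthrich2014] Thm. 16, Lemma 17; Mazur–Tate–Teitelbaum 1986
[MazurTateTeitelbaum1986Invent] §I.8, §I.13–I.14; Greenberg 1999 [GreenbergLNM1716] §5; Pal 2012
[Pal2012] p. 1514, Thm. 3.2; Delbourgo 1998 [Delbourgo1998] §1.5–1.6.
-/

noncomputable section

open scoped Classical MatrixGroups ModularForm

open CongruenceSubgroup WeierstrassCurve Literature.NumberTheory.EllipticCurves
  Literature.NumberTheory.EllipticCurves.ModularForms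
  Literature.NumberTheory.EllipticCurves.Rank1Residual

namespace Summit.BirchSwinnertonDyer.Rank1Residual.Additive

/-! ### The Legendre-twisted minus-symbol sum -/

/-- **`∑_{a mod p} (a/p) · [a/p]⁻_f ∈ ℚ`**, the MINUS modular-symbol sum of `f` twisted by the
Legendre symbol mod `p` (`[r]⁻_f = ratMinusSymbol f r`, normalised by `Ω⁻_f`). Cast to `ℂ` it is
the tree's `ratMinusTwistedSymbolSum f χ_p` for the Jacobi/Legendre character `χ_p`, hence
`τ(χ_p)·L(f, χ_p, 1)/(Ω⁻_f·i)` for `p ≡ 3 (mod 4)` (`χ_p` odd) by Birch's formula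
(Mazur–Tate–Teitelbaum 1986 §I.8 (8.6); tree theorem `ratMinusTwistedSymbolSum_mul_minusPeriod_mul_I`).
A rational number attached to `(f, p)`; nothing asserted. Odd twin of `legendrePlusSymbolSum`. -/
def legendreMinusSymbolSum {N : ℕ} (f : CuspForm (Gamma0 N) 2) (p : ℕ) [Fact p.Prime] : ℚ :=
  ∑ a : ZMod p, (legendreSym p (a.val : ℤ) : ℚ) * ratMinusSymbol f ((a.val : ℚ) / p)

/-- Unfolding lemma for `legendreMinusSymbolSum`. -/
theorem legendreMinusSymbolSum_def {N : ℕ} (f : CuspForm (Gamma0 N) 2) (p : ℕ) [Fact p.Prime] :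
    legendreMinusSymbolSum f p =
      ∑ a : ZMod p, (legendreSym p (a.val : ℤ) : ℚ) * ratMinusSymbol f ((a.val : ℚ) / p) := rfl

/-! ### The typed input, odd branch -/

/-- **[B∘C] at the trivial character, ODD branch (`p ≡ 3 (mod 4)`), TYPED** — the missing input of
line V9 at `(E, p)` for the primes `p ≡ 3 (mod 4)`, in its weakest usable form. For the additive
curve `E = W` at a prime `p ≡ 3 (mod 4)`: whenever `W` is `ℚ`-isomorphic to the quadratic twist by
`−p = p*` of a globally minimal curve `V` (`E♭`) that is good ordinary or multiplicative at `p`,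
`E[p]` is reducible, `f` is the newform of `V`, `κ`/`γ` is the cyclotomic `ℤ_p`-extension of `ℚ` with
a topological generator matching the cyclotomic variable, `D` a Pontryagin-dual datum of
`Sel_{p^∞}(W/ℚ_∞)` and `ϖ⁻ · |Ω⁻(V)| = Ω⁻_f` (`|Ω⁻(V)| = V.imaginaryPeriodRat`, the imaginary Néron
period; `Ω⁻_f = minusPeriod f`), then `X(W/ℚ_∞)` is `Λ`-torsion and SOME `g ∈ char_Λ X(W/ℚ_∞)` has
constant term `g(0) = u · ϖ⁻ · ∑_{a mod p} (a/p)[a/p]⁻_f` for a unit `u ∈ ℤ_p^×` — the `T = 0`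
specialisation of "`char X(E/ℚ_∞) ∋` the `χ_{−p}`-branch of `L_p(E♭)`" (Wuthrich 2014 Thm. 16 for
`E♭` over `ℚ(μ_{p^∞})`, `ω^{(p−1)/2}`-component, transported along
`X(E/ℚ_∞) ≅ X(E♭/ℚ(μ_{p^∞}))^{(χ)}`; value at `T = 0` by Mazur–Tate–Teitelbaum §I.14 with the MINUS
symbol). A predicate on `(W, p)`; its universal closure is the research statement V9 (odd branch)
and is NOT asserted. Odd twin of `ChiBranchLeadingTermAt`.
[cite: Wuthrich2014, Thm. 16 (p. 397) (shape only; nothing asserted)]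
[cite: MazurTateTeitelbaum1986Invent, §I.14 (shape only; nothing asserted)] -/
def ChiBranchLeadingTermOddAt (W : WeierstrassCurve ℚ) (p : ℕ) [Fact p.Prime] : Prop :=
  ∀ (V : WeierstrassCurve ℚ) [V.IsElliptic] [V.IsGloballyMinimal]
    {κ : ZpExtension ℚ p} {γ : Field.absoluteGaloisGroup ℚ} {N : ℕ} [NeZero N]
    {f : CuspForm (Gamma0 N) 2},
    p % 4 = 3 →
    (∃ C : VariableChange ℚ, C • V.quadraticTwist (-(p : ℚ)) = W) →
    (GoodOrd V p ∨ Mult V p) → Red W p →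
    κ.IsCyclotomic → κ.IsTopGenerator γ → IsCyclotomicVariable p γ → IsNewformOf V f →
    ∀ (D : W.SelmerDualData κ γ) (ϖ : ℚ), (ϖ : ℝ) * V.imaginaryPeriodRat = minusPeriod f →
      D.IsTorsion ∧
      ∃ g ∈ D.charIdeal, ∃ u : ℤ_[p]ˣ,
        ((PowerSeries.constantCoeff g : ℤ_[p]) : ℚ_[p]) =
          ((u : ℤ_[p]) : ℚ_[p]) * (ϖ : ℚ_[p]) * (legendreMinusSymbolSum f p : ℚ_[p])

/-- Unfolding lemma for `ChiBranchLeadingTermOddAt` (to apply the predicate as a function). -/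
theorem chiBranchLeadingTermOddAt_iff (W : WeierstrassCurve ℚ) (p : ℕ) [Fact p.Prime] :
    ChiBranchLeadingTermOddAt W p ↔
      ∀ (V : WeierstrassCurve ℚ) [V.IsElliptic] [V.IsGloballyMinimal]
        {κ : ZpExtension ℚ p} {γ : Field.absoluteGaloisGroup ℚ} {N : ℕ} [NeZero N]
        {f : CuspForm (Gamma0 N) 2},
        p % 4 = 3 →
        (∃ C : VariableChange ℚ, C • V.quadraticTwist (-(p : ℚ)) = W) →
        (GoodOrd V p ∨ Mult V p) → Red W p →
        κ.IsCyclotomic → κ.IsTopGenerator γ → IsCyclotomicVariable p γ → IsNewformOf V f →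
        ∀ (D : W.SelmerDualData κ γ) (ϖ : ℚ), (ϖ : ℝ) * V.imaginaryPeriodRat = minusPeriod f →
          D.IsTorsion ∧
          ∃ g ∈ D.charIdeal, ∃ u : ℤ_[p]ˣ,
            ((PowerSeries.constantCoeff g : ℤ_[p]) : ℚ_[p]) =
              ((u : ℤ_[p]) : ℚ_[p]) * (ϖ : ℚ_[p]) * (legendreMinusSymbolSum f p : ℚ_[p]) :=
  Iff.rfl

end Summit.BirchSwinnertonDyer.Rank1Residual.Additive

end
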